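import Summits.BirchSwinnertonDyer.BirchSwinnertonDyer.Theorems.KolyvaginDepthDoorKolyvaginDepthSupplyLeafEigenLine
import Summits.BirchSwinnertonDyer.BirchSwinnertonDyer.Theorems.KolyvaginDepthDoorKolyvaginDepthSupplyLeafReciprocityOfPoitouTate
import Summits.BirchSwinnertonDyer.BirchSwinnertonDyer.Theorems.KolyvaginDepthDoorKolyvaginDepthSupplyDoorNoTwist
import Summits.BirchSwinnertonDyer.BirchSwinnertonDyer.Theorems.KolyvaginDepthDoorKolyvaginDepthSupplyDoorSecondSign
import Literature.NumberTheory.EllipticCurves.HeegnerPointsKolyvaginDepthDescentLeaves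
import Literature.NumberTheory.EllipticCurves.HeegnerPointsKolyvaginGoodReductionProofs
import Literature.NumberTheory.GaloisCohomology.PoitouTateNumberField
import HarnessLib

/-!
# Route `KolyvaginDepthDoor`, crux `KolyvaginDepthSupply` (stmt-BirchSwinnertonDyer-21765) —
# THE TWO LEVEL-`p` GROSS LEAVES DISCHARGED: `Gross1991_prop_8_1_one` and `Gross1991_prop_8_2_finset`
# HOLD (for every `N`, `W`, `K : Type`), and the Gross-currency doors of g5/g6 become leaf-free

Helper file (`--supports stmt-BirchSwinnertonDyer-21765 --as helper`); it closes nothing and BSD is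
not proved by it.

The Literature file `HeegnerPointsKolyvaginDepthDescentLeaves` records two NAMED FACTS without
`_holds` (its docstring: *"Local Tate duality and the reciprocity law for `Br(K)` are not in Mathlib:
named facts, no `_holds`"*), consumed as the hypotheses `hB1`, `hB2` of this route's Gross-currency
doors `…KolyvaginDepthSupplyDoorOfLeaves` / `…DoorNoTwist` (`exists_hypothesesDepth_of_leaves`):

* `Gross1991_prop_8_1_one N W K` — Gross 1991 Prop. 8.1 (1) read for global classes: two Selmer
  `ν`-eigenclasses are dependent in `H¹(K_λ, E_p)` at a Kolyvagin place `λ`;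
* `Gross1991_prop_8_2_finset N W K` — what the proof of Prop. 8.2 proves at finitely many Kolyvagin
  places (McCallum Prop. 2.2 with Lemma 5.3, flag `Gross91-8.2-multiplace`).

Both are now THEOREMS, from engines other cells landed since and that Literature cannot import
(Summits-side, as the ARM-P reader `bsd-cited-r05` asked, 2026-08-28): (8.1 (1)) g8's
`exists_zsmul_add_zsmul_mem_torsionLocalKer_of_eigen` (`…LeafEigenLine`: the `ν`-eigenline of the
Frobenius lift of `c` on `E_p`, Gross Prop. 9.6); (8.2) g8's re-binding of x11b3's reciprocity
`kolyvaginReciprocityFinset_of_poitouTate_of_hasGoodReductionAt` (`…LeafReciprocityOfPoitouTate`, from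
the Poitou–Tate fact) with the Gross-cluster theorem `lemma_5_3_descent_of_reciprocity` at `M = 1`,
`a = 0`, and the tree theorem `poitouTate_sum_localTatePairing_eq_zero_holds` (cell `bsd-cn100`,
`K : Type`). Good reduction of `E/K` at `λ` comes from the Heegner point
(`IsKolyvaginPrime.not_mem_badPlaces`); `λ` is the only place above `ℓ` (`IsKolyvaginPrime.mem_iff`).

* `gross1991_prop_8_1_one_holds : Gross1991_prop_8_1_one N W K` (every universe);
* `gross1991_prop_8_2_finset_of_poitouTate (hPT) : Gross1991_prop_8_2_finset N W K` (every universe,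
  CONDITIONAL on the PT fact) and `gross1991_prop_8_2_finset_holds : Gross1991_prop_8_2_finset N W K`
  for `K : Type`;
* leaf-free Gross-currency doors (`K : Type`): `shaCorank_eq_zero_of_class_ne_zero_of_rank_le_of_classes`
  (g6's `…_of_leaves` minus `hB1 hB2`: classes `cl` with Gross's Props. 5.4 (2) / 6.2 as displayed
  hypotheses, ONE non-zero class of depth `ν`, `ν + 1 ≤ rank E(ℚ)` ⟹ `t_p(E) = 0`, `rank E(ℚ) = ν+1`,
  …), its rank-2 row `shaCorank_eq_zero_of_two_le_rank_of_class_prime_ne_zero_of_classes`, and the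
  second-sign twin `shaCorank_eq_zero_of_class_ne_zero_of_twist_rank_of_classes` (g9's
  `door_of_hypothesesDepth_of_twist_rank`).

HONEST FRAMING: plumbing of other seats' engines into the Literature facts' exact binders; the doors
stay conditional on the displayed Euler-system hypotheses `hcl` (Gross Props. 5.4 (2), 6.2 — for the
concrete classes these are McCallum's sign law (PROVED), Lemma 4.3 (F1 / Kodaira–Néron) and Prop. 4.4
((γ))); nothing is asserted about any curve; BSD is not proved by it.

References: [GrossLMS1991] §7 (7.6), §8 Props. 8.1–8.2, §9 Prop. 9.6, §10; [McCallumLMS1991] §2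
Prop. 2.2, §5 Lemma 5.3; [MilneADT2006] I Thm. 4.10 (b); [Kolyvagin1991MathAnn] Thm. 2.3.
-/

set_option linter.dupNamespace false

noncomputable section

open scoped Classical Pointwise

namespace Summit.BirchSwinnertonDyer.BirchSwinnertonDyer.Theorems.KolyvaginDepthDoor

open Literature.NumberTheory.EllipticCurves Literature.NumberTheory.EllipticCurves.KolyvaginDescent
  Literature.NumberTheory.GaloisRepresentations Literature.NumberTheory.GaloisCohomology WeierstrassCurve
  NumberField IsDedekindDomain Field

universe u

/-! ## §1 Gross 1991 Prop. 8.1 (1) holds -/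

section Leaves

variable (N : ℕ) [NeZero N] (W : WeierstrassCurve ℚ) (K : Type u) [Field K] [NumberField K]

/-- **Gross 1991 Prop. 8.1 (1) HOLDS** — the named fact `Gross1991_prop_8_1_one N W K` (two classes of
`Sel(E/K)_p` in one `ν`-eigenspace of complex conjugation are dependent in `H¹(K_λ, E_p)` at the place
`λ` of a Kolyvagin prime `ℓ`) for every `N`, `W`, `K`: g8's `exists_zsmul_add_zsmul_mem_torsionLocalKer_of_eigen`
(the Frobenius values `[sᵢ, Frob λ]` of unramified classes lie on the `ν`-eigenline of the Frobenius
lift of `c` on `E_p`, Gross Prop. 9.6) under the fact's own binders: good reduction of `E/K` at `λ`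
from the Heegner point (`IsKolyvaginPrime.not_mem_badPlaces`), the Selmer condition at `λ` from
membership in `Sel(E/K)_p`, and `λ` the only place above `ℓ` (`IsKolyvaginPrime.mem_iff`). The fact's
`¬ CM`, discriminant, Heegner-hypothesis and surjectivity binders are idle. Unconditional.
[cite: GrossLMS1991, §8 Prop. 8.1 (1), §9 Prop. 9.6] [cite: McCallumLMS1991, §5 Lemma 5.3] -/
theorem gross1991_prop_8_1_one_holds : Gross1991_prop_8_1_one N W K := by
  intro _ _ hK _ _ P hP p hp hp2 _ c hc ℓ hℓ ν hν s₁ hs₁ hτ₁ s₂ hs₂ hτ₂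
  have hgood : (W.baseChange K).HasGoodReductionAt hℓ.place := by
    have h := IsKolyvaginPrime.not_mem_badPlaces (W := W) hP hℓ
    rwa [WeierstrassCurve.mem_badPlaces_iff, not_not] at h
  have hs₁' : s₁ ∈ selmerLocalKer (W.baseChange K) (hℓ.place.adicCompletion K) p :=
    ((mem_selmerGroup_iff _ _ s₁).mp hs₁).1 hℓ.place
  have hs₂' : s₂ ∈ selmerLocalKer (W.baseChange K) (hℓ.place.adicCompletion K) p :=
    ((mem_selmerGroup_iff _ _ s₂).mp hs₂).1 hℓ.place
  obtain ⟨a, b, hab, hmem⟩ := exists_zsmul_add_zsmul_mem_torsionLocalKer_of_eigen W hK hp hp2 hc hℓ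
    hgood hν hs₁' hτ₁ hs₂' hτ₂
  refine ⟨a, b, hab, fun v hv ↦ ?_⟩
  have hveq : v = hℓ.place := hℓ.mem_iff.mp hv
  subst hveq
  exact hmem

/-! ## §2 Gross 1991 Prop. 8.2 at finitely many Kolyvagin places holds -/

/-- **Gross 1991 Prop. 8.2 at finitely many Kolyvagin places, from Poitou–Tate** — the named fact
`Gross1991_prop_8_2_finset N W K` for every `N`, `W`, `K`, CONDITIONAL on the Poitou–Tate fact
`poitouTate_sum_localTatePairing_eq_zero K` (any universe). Proof = g8's
`prop22_reciprocity_eigen_finset_one_of_poitouTate` transposed to Gross's currency: Kolyvagin's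
reciprocity (R)₁ at `λ ∣ ℓ` against `s ∈ Sel_p(E/K)` vanishing on the places of `T ∖ {ℓ}`
(`kolyvaginReciprocityFinset_of_poitouTate_of_hasGoodReductionAt` at `M = 1`, level `p¹ = p`), then
McCallum's Lemma 5.3 with Prop. 2.2 (`lemma_5_3_descent_of_reciprocity`, `M = 1`, `a = 0`, `q = p`)
contrapositively; good reduction at `λ` from the Heegner point. [cite: GrossLMS1991, §8 Prop. 8.2 (proof) with Prop. 8.1 (2)]
[cite: McCallumLMS1991, §2 Prop. 2.2, §5 Lemma 5.3] [cite: MilneADT2006, Ch. I Thm. 4.10(b)] -/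
theorem gross1991_prop_8_2_finset_of_poitouTate (hPT : poitouTate_sum_localTatePairing_eq_zero K) :
    Gross1991_prop_8_2_finset N W K := by
  intro _ _ hK _ _ P hP p hp hp2 _ c hc T hT ℓ hℓT ν hν d hd hfin hinf s hs hτs hsT v hv hsv
  haveI : Fact p.Prime := ⟨hp⟩
  have hℓ : IsKolyvaginPrime N W K p ℓ := hT ℓ hℓT
  have hveq : v = hℓ.place := hℓ.mem_iff.mp hv
  subst hveq
  by_contra hdv
  -- good reduction of `E/K` at `λ`, from the Heegner point
  have hgood : (W.baseChange K).HasGoodReductionAt hℓ.place := by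
    have h := IsKolyvaginPrime.not_mem_badPlaces (W := W) hP hℓ
    rwa [WeierstrassCurve.mem_badPlaces_iff, not_not] at h
  have hfrob : FrobEqFrobInfty W K p ℓ := hℓ.2.2.2.2.2
  -- (R)_1 against `s` vanishing on the places of `T ∖ {ℓ}` (level `p ^ 1`, read at level `p`)
  have hR0 := kolyvaginReciprocityFinset_of_poitouTate_of_hasGoodReductionAt N W K hPT hp (M := 1)
    le_rfl hℓ hgood
  rw [pow_one] at hR0
  obtain ⟨A, _, eA, halt, hnd, hR⟩ := hR0
  let T' : Finset (HeightOneSpectrum (𝓞 K)) :=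
    (T.erase ℓ).attach.image fun r ↦ (hT r.1 (Finset.mem_of_mem_erase r.2)).place
  have hsT' : ∀ v' ∈ T', s ∈ (W.baseChange K).torsionLocalKer (v'.adicCompletion K) p := by
    intro v' hv'
    obtain ⟨r, -, rfl⟩ := Finset.mem_image.mp hv'
    obtain ⟨hrℓ, hrT⟩ := Finset.mem_erase.mp r.2
    exact hsT r.1 hrT hrℓ _ (hT r.1 hrT).mem_place
  have hfin' : ∀ v' : HeightOneSpectrum (𝓞 K), v' ∉ T' → (ℓ : 𝓞 K) ∉ v'.asIdeal →
      d ∈ selmerLocalKer (W.baseChange K) (v'.adicCompletion K) p := by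
    intro v' hv'T hℓv'
    refine hfin v' fun r hr hrv' ↦ ?_
    by_cases hrℓ : r = ℓ
    · exact hℓv' (hrℓ ▸ hrv')
    · apply hv'T
      have hv'eq : v' = (hT r hr).place := (hT r hr).mem_iff.mp hrv'
      exact Finset.mem_image.mpr ⟨⟨r, Finset.mem_erase.mpr ⟨hrℓ, hr⟩⟩, Finset.mem_attach _ _,
        hv'eq.symm⟩
  have hRx := hR T' s hs hsT' d hfin' hinf
  -- McCallum's Lemma 5.3 with Prop. 2.2 at `M = 1`, `a = 0`, level `q = p`
  have hdv' : ((p : ℤ) ^ 0) • d ∉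
      selmerLocalKer (W.baseChange K) (hℓ.place.adicCompletion K) p := by
    rwa [pow_zero, one_zsmul]
  have h53 := lemma_5_3_descent_of_reciprocity W hK hp hp2 hc hℓ (M := 1) le_rfl (q := p)
    (pow_one p).symm hfrob hgood eA halt hnd hν hd hdv' hs hτs hRx
  rw [show 1 - 1 - 0 = 0 from rfl, pow_zero, one_zsmul] at h53
  exact hsv h53

end Leaves

/-- **Gross 1991 Prop. 8.2 at finitely many Kolyvagin places HOLDS** for every `N`, `W` and every
number field `K : Type` (the universe of the tree's Poitou–Tate discharge
`poitouTate_sum_localTatePairing_eq_zero_holds`, cell `bsd-cn100`). With `gross1991_prop_8_1_one_holds`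
both §8 leaves of `exists_hypothesesDepth_of_leaves` are theorems. [cite: GrossLMS1991, §8 Prop. 8.2]
[cite: McCallumLMS1991, §2 Prop. 2.2, §5 Lemma 5.3] [cite: CasselsFrohlichANT1967, Ch. VII §11] -/
theorem gross1991_prop_8_2_finset_holds (N : ℕ) [NeZero N] (W : WeierstrassCurve ℚ) (K : Type)
    [Field K] [NumberField K] : Gross1991_prop_8_2_finset N W K :=
  gross1991_prop_8_2_finset_of_poitouTate N W K (poitouTate_sum_localTatePairing_eq_zero_holds K)

/-! ## §3 The Gross-currency doors, leaf-free -/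

section Doors

variable {N : ℕ} [NeZero N] (W : WeierstrassCurve ℚ) [W.IsElliptic] (K : Type) [Field K]
  [NumberField K]

/-- **The twist-free door in Gross's currency, LEAF-FREE** — g6's
`shaCorank_eq_zero_of_class_ne_zero_of_rank_le_of_leaves` with `hB1`, `hB2` DISCHARGED
(`gross1991_prop_8_1_one_holds`, `gross1991_prop_8_2_finset_holds`). Setting: `E = W/ℚ` elliptic
without CM, `K` imaginary quadratic (`d_K ∉ {−3, −4}`, Heegner hypothesis for `N`, a Heegner point `P`
of level `N`), `p` odd with `ρ̄_{E,p}` onto, `c` the complex conjugation, a sign `ε`, classes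
`cl : ℕ → H¹(K, E[p])` with Gross's Props. 5.4 (2) and 6.2 as displayed hypotheses `hcl`. If `cl n ≠ 0`
at a square-free product `n` of Kolyvagin primes with `ν` prime factors and `ν + 1 ≤ rank E(ℚ)`, then
`corank_{ℤ_p} Ш(E/ℚ)[p^∞] = 0`, `rank E(ℚ) = ν + 1`, `rank E^{(d_K)}(ℚ) ≤ ν`, `#E(ℚ)[p] = 1`,
`Ш(E/ℚ)[p] = 0`, `#Sel_p(E/ℚ) = p^{ν+1}`. CONDITIONAL on `hcl` only; per-curve; BSD is not proved by
it. [cite: Kolyvagin1991MathAnn, Thm. 2.3] [cite: GrossLMS1991, §5 (5.1), §10 with Props. 5.4, 6.2, 8.1, 8.2] -/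
theorem shaCorank_eq_zero_of_class_ne_zero_of_rank_le_of_classes
    (hE : ¬ W.HasCM) (hK : IsImaginaryQuadratic K)
    (hD : NumberField.discr K ≠ -3 ∧ NumberField.discr K ≠ -4) (hH : SatisfiesHeegnerHypothesis N K)
    {P : (W.baseChange K).toAffine.Point} (hP : IsHeegnerPoint N W K P) (p : ℕ) [hp : Fact p.Prime]
    (hp2 : p ≠ 2) (hρ : W.HasSurjectiveModNGaloisRep p) (c : K ≃ₐ[ℚ] K) (hc : c ≠ 1)
    (hcc : c * c = 1) (ε : ℤ) (hε : ε = 1 ∨ ε = -1) (cl : ℕ → galH1Torsion (W.baseChange K) p)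
    (hcl : ∀ n : ℕ, Squarefree n → (∀ q ∈ n.primeFactors, IsKolyvaginPrime N W K p q) →
      conjAct W c p (cl n) = (ε * (-1) ^ n.primeFactors.card) • cl n ∧
      (∀ v : HeightOneSpectrum (𝓞 K), (n : 𝓞 K) ∉ v.asIdeal →
        cl n ∈ selmerLocalKer (W.baseChange K) (v.adicCompletion K) p) ∧
      (∀ w : InfinitePlace K, cl n ∈ selmerLocalKer (W.baseChange K) w.Completion p) ∧
      (∀ ℓ : ℕ, ℓ.Prime → ℓ ∣ n → ∀ v : HeightOneSpectrum (𝓞 K), (ℓ : 𝓞 K) ∈ v.asIdeal →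
        (cl n ∈ selmerLocalKer (W.baseChange K) (v.adicCompletion K) p ↔
          cl (n / ℓ) ∈ (W.baseChange K).torsionLocalKer (v.adicCompletion K) p)))
    {n : ℕ} (hn : Squarefree n) (hkn : ∀ q ∈ n.primeFactors, IsKolyvaginPrime N W K p q)
    (hne : cl n ≠ 0) (hrank : n.primeFactors.card + 1 ≤ W.mordellWeilRank) :
    W.shaCorank p = 0 ∧ W.mordellWeilRank = n.primeFactors.card + 1 ∧
      (W.quadraticTwist (NumberField.discr K : ℚ)).mordellWeilRank ≤ n.primeFactors.card ∧
      Nat.card ↥(AddSubgroup.torsionBy W.toAffine.Point (p : ℤ)) = 1 ∧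
      W.sha ⊓ AddSubgroup.torsionBy W.galH1 (p : ℤ) = ⊥ ∧
      Nat.card ↥(selmerGroup W (p : ℤ)) = p ^ (n.primeFactors.card + 1) :=
  shaCorank_eq_zero_of_class_ne_zero_of_rank_le_of_leaves W K (gross1991_prop_8_1_one_holds N W K)
    (gross1991_prop_8_2_finset_holds N W K) hE hK hD hH hP p hp2 hρ c hc hcc ε hε cl hcl hn hkn hne
    hrank

/-- **The rank-2 row in Gross's currency, LEAF-FREE**: ONE Kolyvagin prime `ℓ` with `cl ℓ ≠ 0` and two
independent points on `E(ℚ)` give `corank_{ℤ_p} Ш(E/ℚ)[p^∞] = 0`, `rank E(ℚ) = 2`,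
`rank E^{(d_K)}(ℚ) ≤ 1`, `E(ℚ)[p] = 0`, `Ш(E/ℚ)[p] = 0`, `#Sel_p(E/ℚ) = p²` — g6's
`shaCorank_eq_zero_of_two_le_rank_of_class_prime_ne_zero_of_leaves` with `hB1`, `hB2` discharged.
CONDITIONAL on `hcl` only; per-curve; BSD is not proved by it. [cite: Kolyvagin1991MathAnn, Thm. 2.3]
[cite: GrossLMS1991, §5 (5.1) and §10] [cite: JetchevLauterStein2009, §3.6 (arXiv:0707.0032)] -/
theorem shaCorank_eq_zero_of_two_le_rank_of_class_prime_ne_zero_of_classes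
    (hE : ¬ W.HasCM) (hK : IsImaginaryQuadratic K)
    (hD : NumberField.discr K ≠ -3 ∧ NumberField.discr K ≠ -4) (hH : SatisfiesHeegnerHypothesis N K)
    {P : (W.baseChange K).toAffine.Point} (hP : IsHeegnerPoint N W K P) (p : ℕ) [hp : Fact p.Prime]
    (hp2 : p ≠ 2) (hρ : W.HasSurjectiveModNGaloisRep p) (c : K ≃ₐ[ℚ] K) (hc : c ≠ 1)
    (hcc : c * c = 1) (ε : ℤ) (hε : ε = 1 ∨ ε = -1) (cl : ℕ → galH1Torsion (W.baseChange K) p)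
    (hcl : ∀ n : ℕ, Squarefree n → (∀ q ∈ n.primeFactors, IsKolyvaginPrime N W K p q) →
      conjAct W c p (cl n) = (ε * (-1) ^ n.primeFactors.card) • cl n ∧
      (∀ v : HeightOneSpectrum (𝓞 K), (n : 𝓞 K) ∉ v.asIdeal →
        cl n ∈ selmerLocalKer (W.baseChange K) (v.adicCompletion K) p) ∧
      (∀ w : InfinitePlace K, cl n ∈ selmerLocalKer (W.baseChange K) w.Completion p) ∧
      (∀ ℓ : ℕ, ℓ.Prime → ℓ ∣ n → ∀ v : HeightOneSpectrum (𝓞 K), (ℓ : 𝓞 K) ∈ v.asIdeal →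
        (cl n ∈ selmerLocalKer (W.baseChange K) (v.adicCompletion K) p ↔
          cl (n / ℓ) ∈ (W.baseChange K).torsionLocalKer (v.adicCompletion K) p)))
    {ℓ : ℕ} (hℓ : IsKolyvaginPrime N W K p ℓ) (hne : cl ℓ ≠ 0) (h2 : 2 ≤ W.mordellWeilRank) :
    W.shaCorank p = 0 ∧ W.mordellWeilRank = 2 ∧
      (W.quadraticTwist (NumberField.discr K : ℚ)).mordellWeilRank ≤ 1 ∧
      Nat.card ↥(AddSubgroup.torsionBy W.toAffine.Point (p : ℤ)) = 1 ∧
      W.sha ⊓ AddSubgroup.torsionBy W.galH1 (p : ℤ) = ⊥ ∧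
      Nat.card ↥(selmerGroup W (p : ℤ)) = p ^ 2 :=
  shaCorank_eq_zero_of_two_le_rank_of_class_prime_ne_zero_of_leaves W K
    (gross1991_prop_8_1_one_holds N W K) (gross1991_prop_8_2_finset_holds N W K) hE hK hD hH hP p
    hp2 hρ c hc hcc ε hε cl hcl hℓ hne h2

/-- **The door on the second sign in Gross's currency, LEAF-FREE**: same setting and `hcl`; if
`cl n ≠ 0` at depth `ν` and — points first — `ν ≤ rank E(ℚ)`, `ν + 1 ≤ rank E^{(d_K)}(ℚ)` (the crux's
second rank clause; the habitat of rank-`0` curves), then `corank_{ℤ_p} Ш(E/ℚ)[p^∞] = 0`,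
`rank E(ℚ) = ν`, `corank_{ℤ_p} Ш(E^{(d_K)}/ℚ)[p^∞] = 0`, `rank E^{(d_K)}(ℚ) = ν + 1`, `#E(ℚ)[p] = 1`,
`Ш(E/ℚ)[p] = 0`, `#Sel_p(E/ℚ) = p^{ν}`, `Ш(E^{(d_K)}/ℚ)[p] = 0`, `#Sel_p(E^{(d_K)}/ℚ) = p^{ν+1}`
(`door_of_hypothesesDepth_of_twist_rank` on `exists_hypothesesDepth_of_leaves` with the two leaves
discharged). CONDITIONAL on `hcl` only; per-curve; BSD is not proved by it.
[cite: Kolyvagin1991MathAnn, Thm. 2.3] [cite: GrossLMS1991, §5 (5.1) and §10] -/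
theorem shaCorank_eq_zero_of_class_ne_zero_of_twist_rank_of_classes
    (hE : ¬ W.HasCM) (hK : IsImaginaryQuadratic K)
    (hD : NumberField.discr K ≠ -3 ∧ NumberField.discr K ≠ -4) (hH : SatisfiesHeegnerHypothesis N K)
    {P : (W.baseChange K).toAffine.Point} (hP : IsHeegnerPoint N W K P) (p : ℕ) [hp : Fact p.Prime]
    (hp2 : p ≠ 2) (hρ : W.HasSurjectiveModNGaloisRep p) (c : K ≃ₐ[ℚ] K) (hc : c ≠ 1)
    (hcc : c * c = 1) (ε : ℤ) (hε : ε = 1 ∨ ε = -1) (cl : ℕ → galH1Torsion (W.baseChange K) p)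
    (hcl : ∀ n : ℕ, Squarefree n → (∀ q ∈ n.primeFactors, IsKolyvaginPrime N W K p q) →
      conjAct W c p (cl n) = (ε * (-1) ^ n.primeFactors.card) • cl n ∧
      (∀ v : HeightOneSpectrum (𝓞 K), (n : 𝓞 K) ∉ v.asIdeal →
        cl n ∈ selmerLocalKer (W.baseChange K) (v.adicCompletion K) p) ∧
      (∀ w : InfinitePlace K, cl n ∈ selmerLocalKer (W.baseChange K) w.Completion p) ∧
      (∀ ℓ : ℕ, ℓ.Prime → ℓ ∣ n → ∀ v : HeightOneSpectrum (𝓞 K), (ℓ : 𝓞 K) ∈ v.asIdeal →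
        (cl n ∈ selmerLocalKer (W.baseChange K) (v.adicCompletion K) p ↔
          cl (n / ℓ) ∈ (W.baseChange K).torsionLocalKer (v.adicCompletion K) p)))
    {n : ℕ} (hn : Squarefree n) (hkn : ∀ q ∈ n.primeFactors, IsKolyvaginPrime N W K p q)
    (hne : cl n ≠ 0) (hrank : n.primeFactors.card ≤ W.mordellWeilRank)
    (hrank' : n.primeFactors.card + 1 ≤ (W.quadraticTwist (NumberField.discr K : ℚ)).mordellWeilRank) :
    W.shaCorank p = 0 ∧ W.mordellWeilRank = n.primeFactors.card ∧
      (W.quadraticTwist (NumberField.discr K : ℚ)).shaCorank p = 0 ∧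
      (W.quadraticTwist (NumberField.discr K : ℚ)).mordellWeilRank = n.primeFactors.card + 1 ∧
      Nat.card ↥(AddSubgroup.torsionBy W.toAffine.Point (p : ℤ)) = 1 ∧
      W.sha ⊓ AddSubgroup.torsionBy W.galH1 (p : ℤ) = ⊥ ∧
      Nat.card ↥(selmerGroup W (p : ℤ)) = p ^ n.primeFactors.card ∧
      (W.quadraticTwist (NumberField.discr K : ℚ)).sha ⊓
          AddSubgroup.torsionBy (W.quadraticTwist (NumberField.discr K : ℚ)).galH1 (p : ℤ) = ⊥ ∧
      Nat.card ↥(selmerGroup (W.quadraticTwist (NumberField.discr K : ℚ)) (p : ℤ)) =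
        p ^ (n.primeFactors.card + 1) := by
  obtain ⟨S, hSel, hSp, hSc, hSK, hSτ⟩ := exists_hypothesesDepth_of_leaves
    (gross1991_prop_8_1_one_holds N W K) (gross1991_prop_8_2_finset_holds N W K) hE hK hD hH hP
    hp.out hp2 hρ c hc hcc ε hε cl hcl
  have hsupp : KolSupp S.Kol n := by rw [hSK]; exact ⟨hn, hkn⟩
  have hne' : S.c n ≠ 0 := by rw [hSc]; exact hne
  exact door_of_hypothesesDepth_of_twist_rank W K hK.1 c hc p hp2 rfl S hSel hSp hSτ hsupp hne' hrank
    hrank'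

end Doors

end Summit.BirchSwinnertonDyer.BirchSwinnertonDyer.Theorems.KolyvaginDepthDoor

end
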